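import Summits.QuantumFields.QCD.Theses.DiagonalSpine
import Literature.MathematicalPhysics.QuantumFieldTheory.QCDGoldstoneBound
import HarnessLib

/-!
# Route `DiagonalSpine` (QCD): the support item `SubsequenceStability` (stmt-QuantumFields-8931)

Restricting a `QCDRegularisation` along a strictly increasing `φ` (all data composed with `φ`; the tree's
`QCDRegularisation.restrict`, Literature `QCDGoldstoneBound`) preserves leading-log mass scaling, two-loop asymptotic scaling,
the uniform lattice gap `HasLatticeMassGap Δ` at every mass tuple, and the physical-branch clause — all tail properties
(`Tendsto` / `∀ᶠ` along `atTop`), and `φ → ∞` (`StrictMono.tendsto_atTop`).  Nothing is asserted about QCD beyond that; no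
summit, leg or crux statement is proved (width seat ym-t4-w17 g0, free hands; the item carried an unlanded candidate proof of
2026-08-15 by grounder g21-0, unreadable from this seat — re-derived here).
-/

set_option autoImplicit false

namespace Summit.QuantumFields.QCD.Theorems

open Filter Topology Literature.MathematicalPhysics.QuantumFieldTheory

/-- **Subsequence stability of the regularisation data** (the item, at `reg' := reg.restrict φ`). [folklore] -/
theorem regularisation_restrict_stable (Nf : ℕ) (reg : QCDRegularisation Nf) (φ : ℕ → ℕ) (hφ : StrictMono φ) :
    ∃ reg' : QCDRegularisation Nf, reg'.a = reg.a ∘ φ ∧ reg'.β = reg.β ∘ φ ∧ reg'.L = reg.L ∘ φ ∧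
      reg'.mcrit = reg.mcrit ∘ φ ∧ reg'.Zm = reg.Zm ∘ φ ∧ (reg.HasMassScaling → reg'.HasMassScaling) ∧
      ((reg.scheme 0 0 0).HasAsymptoticScaling → (reg'.scheme 0 0 0).HasAsymptoticScaling) ∧
      ∀ (m : Fin Nf → ℝ) (Δ : ℝ), ((reg.scheme m 0 0).HasLatticeMassGap Δ → (reg'.scheme m 0 0).HasLatticeMassGap Δ) ∧
        ∀ f, (∀ᶠ k in atTop, -1 < (reg.scheme m 0 0).mq f k) → ∀ᶠ k in atTop, -1 < (reg'.scheme m 0 0).mq f k := by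
  have hφt : Tendsto φ atTop atTop := hφ.tendsto_atTop
  refine ⟨reg.restrict φ hφt, rfl, rfl, rfl, rfl, rfl, ?_, ?_, fun m Δ => ⟨?_, fun f hf => ?_⟩⟩
  · -- leading-log mass scaling is a `Tendsto` along `atTop`
    rintro ⟨c, hc, h⟩
    exact ⟨c, hc, h.comp hφt⟩
  · -- two-loop asymptotic scaling is a `Tendsto` along `atTop`
    rintro ⟨Λ, hΛ, h⟩
    exact ⟨Λ, hΛ, h.comp hφt⟩
  · -- the uniform lattice gap is an `∀ᶠ` along `atTop`
    intro h R R' A B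
    obtain ⟨C, hC⟩ := h R R' A B
    exact ⟨C, (hφt.eventually hC).mono fun k hk => hk⟩
  · -- the physical-branch clause is an `∀ᶠ` along `atTop`
    exact (hφt.eventually hf).mono fun k hk => hk

/-- **Item stmt-QuantumFields-8931 `DiagonalSpine.SubsequenceStability` holds.** [folklore] -/
theorem diagonalSpine_subsequenceStability_proof :
    Summit.QuantumFields.QCD.Theses.DiagonalSpine.SubsequenceStability := by
  unfold Summit.QuantumFields.QCD.Theses.DiagonalSpine.SubsequenceStability
  intro Nf reg φ hφ
  exact regularisation_restrict_stable Nf reg φ hφ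

end Summit.QuantumFields.QCD.Theorems
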